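import Mathlib
import Summits.Ventures.HodgeRepro.Tier4.Target
import Summits.Ventures.HodgeRepro.Tier4.Common.TargetBall
import Summits.Ventures.HodgeRepro.Tier4.Common.TargetCalculus
import Summits.Ventures.HodgeRepro.Tier4.Common.TargetJacobian
import Summits.Ventures.HodgeRepro.Tier4.Common.AutForms

/-!
# Tier4/Line3/BallChangeOfVariables — change of variables on the ball under `U(2,1)` and the invariant measure

Blind re-derivation cell `pub-hodge-repro`, Tier 4 «PROVE THE STEP» (README §9–§10), LINE L3, seat t4-L3-p1 (prover);
support module (S1)/(S2) of L3.6a `term_main_unfold` (lead S12253; plan-3's transfer R6, S12250 (3)), shared with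
L3.4 / L3.5.  Mathlib-level: nothing of the line's data enters.

CONTENT.
* `U(2,1)` facts: `M ∈ U(2,1)` (`Mᴴ J M = J`) is a unit with `normSq (det M) = 1`, `M⁻¹ ∈ U(2,1)`, `actM M` is a
  bijection of the ball (`actM_image_ball`, `actM_injOn_ball`).
* THE COMPLEX JACOBIAN IS `jacDetMap`: the `ℂ`-determinant of `fderiv ℂ (actM M) z` is typer-2's
  `jacDetMap (actM M) z` (`det_fderiv_actM`), and the REAL Jacobian determinant of the same map is its `normSq`
  (`LinearMap.det_restrictScalars`, `Algebra.norm_complex_eq`).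
* (S1) CHANGE OF VARIABLES: for `M ∈ U(2,1)` and any `g : ℂ² → ℂ`,
  `∫ w in ball, g w = ∫ z in ball, (normSq (jacDetMap (actM M) z) : ℂ) * g (actM M z)`
  (`integral_ball_actM`; Mathlib's `integral_image_eq_integral_abs_det_fderiv_smul`).
* (S2) THE INVARIANT DENSITY: `normSq (jacDetMap (actM M) z) = ((1 − nsq (actM M z)) / (1 − nsq z)) ^ 3` on the ball
  (`normSq_jacDetMap_actM`; typer-2's `jacDetMap_actM = det M / w₂³` and `1 − nsq (actM M z) = (1 − nsq z) / ‖w₂‖²`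
  from `quadJ_mulVec` + `lift3_actM`), hence the measure `(1 − nsq z)^{−3} dLeb` on the ball is `actM M`-invariant:
  `∫ w in ball, g w / (1 − nsq w) ^ 3 = ∫ z in ball, g (actM M z) / (1 − nsq z) ^ 3` (`integral_ball_actM_inv`).

Nothing here asserts anything about the truth of (P); HC_CM is NOT proved by anyone in this repository.
-/

set_option autoImplicit false

noncomputable section

namespace Summit.Ventures.HodgeRepro.Tier4.Line3

open Summit.Ventures.HodgeRepro.Tier4
open Matrix MeasureTheory

/-! ## 1. `U(2,1)` -/

section Unitary

variable {M : Matrix (Fin 3) (Fin 3) ℂ}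

/-- `det J = −1`. -/
theorem det_J : J.det = -1 := by
  simp [J, Matrix.det_diagonal, Fin.prod_univ_three]

/-- `M ∈ U(2,1)` has `normSq (det M) = 1`. -/
theorem normSq_det_of_unitaryJ (hM : Mᴴ * J * M = J) : Complex.normSq M.det = 1 := by
  have hdet : Mᴴ.det * J.det * M.det = J.det := by
    rw [← Matrix.det_mul, ← Matrix.det_mul, hM]
  rw [Matrix.det_conjTranspose, det_J] at hdet
  have h : (starRingEnd ℂ) M.det * M.det = 1 := by
    have : -(star M.det * M.det) = -1 := by linear_combination hdet
    rw [Complex.star_def] at this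
    linear_combination -this
  rw [← Complex.normSq_eq_conj_mul_self] at h
  exact_mod_cast h

/-- `M ∈ U(2,1)` is a unit. -/
theorem isUnit_of_unitaryJ (hM : Mᴴ * J * M = J) : IsUnit M := by
  rw [Matrix.isUnit_iff_isUnit_det, isUnit_iff_ne_zero]
  intro h0
  have := normSq_det_of_unitaryJ hM
  rw [h0, map_zero] at this
  exact zero_ne_one this

/-- `M ∈ U(2,1)` has `det M ≠ 0`. -/
theorem det_ne_zero_of_unitaryJ (hM : Mᴴ * J * M = J) : M.det ≠ 0 :=
  isUnit_iff_ne_zero.mp ((Matrix.isUnit_iff_isUnit_det M).mp (isUnit_of_unitaryJ hM))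

/-- The inverse of `M ∈ U(2,1)` is in `U(2,1)`. -/
theorem inv_unitaryJ (hM : Mᴴ * J * M = J) : M⁻¹ᴴ * J * M⁻¹ = J := by
  have hd : IsUnit M.det := (Matrix.isUnit_iff_isUnit_det M).mp (isUnit_of_unitaryJ hM)
  have hdH : IsUnit Mᴴ.det := by
    rw [Matrix.det_conjTranspose, isUnit_iff_ne_zero, star_ne_zero]
    exact isUnit_iff_ne_zero.mp hd
  have h1 : Mᴴ * J = J * M⁻¹ := by
    calc Mᴴ * J = Mᴴ * J * M * M⁻¹ := by rw [Matrix.mul_assoc, Matrix.mul_nonsing_inv M hd, Matrix.mul_one]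
      _ = J * M⁻¹ := by rw [hM]
  calc M⁻¹ᴴ * J * M⁻¹ = Mᴴ⁻¹ * (J * M⁻¹) := by rw [Matrix.conjTranspose_nonsing_inv, Matrix.mul_assoc]
    _ = Mᴴ⁻¹ * (Mᴴ * J) := by rw [h1]
    _ = J := by rw [← Matrix.mul_assoc, Matrix.nonsing_inv_mul Mᴴ hdH, Matrix.one_mul]

/-- `actM M⁻¹` inverts `actM M` on the ball. -/
theorem actM_inv_actM (hM : Mᴴ * J * M = J) {z : Fin 2 → ℂ} (hz : z ∈ ball) : actM M⁻¹ (actM M z) = z := by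
  rw [← actM_mul hM hz, Matrix.nonsing_inv_mul M ((Matrix.isUnit_iff_isUnit_det M).mp (isUnit_of_unitaryJ hM)),
    actM_one']

/-- `actM M` inverts `actM M⁻¹` on the ball. -/
theorem actM_actM_inv (hM : Mᴴ * J * M = J) {w : Fin 2 → ℂ} (hw : w ∈ ball) : actM M (actM M⁻¹ w) = w := by
  rw [← actM_mul (inv_unitaryJ hM) hw, Matrix.mul_nonsing_inv M ((Matrix.isUnit_iff_isUnit_det M).mp
    (isUnit_of_unitaryJ hM)), actM_one']

/-- `actM M` maps the ball ONTO the ball. -/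
theorem actM_image_ball (hM : Mᴴ * J * M = J) : actM M '' ball = ball := by
  apply Set.Subset.antisymm
  · rintro _ ⟨z, hz, rfl⟩
    exact actM_mem_ball hM hz
  · intro w hw
    exact ⟨actM M⁻¹ w, actM_mem_ball (inv_unitaryJ hM) hw, actM_actM_inv hM hw⟩

/-- `actM M` is injective on the ball. -/
theorem actM_injOn_ball (hM : Mᴴ * J * M = J) : Set.InjOn (actM M) ball := by
  intro z hz z' hz' h
  rw [← actM_inv_actM hM hz, ← actM_inv_actM hM hz', h]

end Unitary

/-! ## 2. The Jacobian determinants of `actM M` -/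

section Jacobian

variable {M : Matrix (Fin 3) (Fin 3) ℂ}

/-- The complex determinant of the derivative of a map `φ : ℂ² → ℂ²` differentiable at `z` is `jacDetMap φ z`. -/
theorem det_fderiv_eq_jacDetMap {φ : (Fin 2 → ℂ) → (Fin 2 → ℂ)} {z : Fin 2 → ℂ}
    (hφ : DifferentiableAt ℂ φ z) : LinearMap.det (fderiv ℂ φ z : (Fin 2 → ℂ) →ₗ[ℂ] (Fin 2 → ℂ)) = jacDetMap φ z := by
  have hcomp : ∀ i, DifferentiableAt ℂ (fun w => φ w i) z := differentiableAt_pi.mp hφ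
  have hfd : fderiv ℂ φ z = ContinuousLinearMap.pi fun i => fderiv ℂ (fun w => φ w i) z := fderiv_pi hcomp
  rw [← LinearMap.det_toMatrix', Matrix.det_fin_two]
  simp only [LinearMap.toMatrix'_apply, ContinuousLinearMap.coe_coe, hfd, ContinuousLinearMap.pi_apply]
  simp only [jacDetMap, wedge, pd]

/-- The real Jacobian determinant of a map `φ : ℂ² → ℂ²` differentiable at `z` is `normSq (jacDetMap φ z)`. -/
theorem det_restrictScalars_fderiv {φ : (Fin 2 → ℂ) → (Fin 2 → ℂ)} {z : Fin 2 → ℂ}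
    (hφ : DifferentiableAt ℂ φ z) :
    ((fderiv ℂ φ z).restrictScalars ℝ).det = Complex.normSq (jacDetMap φ z) := by
  rw [ContinuousLinearMap.det, ContinuousLinearMap.coe_restrictScalars, LinearMap.det_restrictScalars,
    det_fderiv_eq_jacDetMap hφ, Algebra.norm_complex_eq]
  rfl

end Jacobian

/-! ## 3. (S1) Change of variables on the ball -/

section ChangeOfVariables

variable {M : Matrix (Fin 3) (Fin 3) ℂ}

/-- **CHANGE OF VARIABLES ON THE BALL**: for `M ∈ U(2,1)`,
`∫_𝔹 g(w) dw = ∫_𝔹 |det Jac(actM M)(z)|² g(actM M z) dz`. -/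
theorem integral_ball_actM (hM : Mᴴ * J * M = J) (g : (Fin 2 → ℂ) → ℂ) :
    ∫ w in ball, g w = ∫ z in ball, (Complex.normSq (jacDetMap (actM M) z) : ℂ) * g (actM M z) := by
  have hdiff : ∀ z ∈ ball, DifferentiableAt ℂ (actM M) z := fun z hz =>
    (differentiableOn_actM hM).differentiableAt (isOpen_ball.mem_nhds hz)
  have hf' : ∀ z ∈ ball, HasFDerivWithinAt (actM M) ((fderiv ℂ (actM M) z).restrictScalars ℝ) ball z :=
    fun z hz => ((hdiff z hz).hasFDerivAt.restrictScalars ℝ).hasFDerivWithinAt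
  have h := integral_image_eq_integral_abs_det_fderiv_smul (μ := volume) isOpen_ball.measurableSet hf'
    (actM_injOn_ball hM) g
  rw [actM_image_ball hM] at h
  rw [h]
  refine setIntegral_congr_fun isOpen_ball.measurableSet fun z hz => ?_
  rw [det_restrictScalars_fderiv (hdiff z hz), abs_of_nonneg (Complex.normSq_nonneg _), Complex.real_smul]

end ChangeOfVariables

/-! ## 4. (S2) The invariant density -/

section Invariant

variable {M : Matrix (Fin 3) (Fin 3) ℂ}

/-- `1 − nsq (actM M z) = (1 − nsq z) / ‖(M (z,1))₂‖²` for `M ∈ U(2,1)`, `z ∈ ball`. -/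
theorem one_sub_nsq_actM (hM : Mᴴ * J * M = J) {z : Fin 2 → ℂ} (hz : z ∈ ball) :
    1 - nsq (actM M z) = (1 - nsq z) / ‖(M *ᵥ lift3 z) 2‖ ^ 2 := by
  have h2 := mulVec_lift3_two_ne_zero hM hz
  have hq : quadJ (M *ᵥ lift3 z) = nsq z - 1 := by rw [quadJ_mulVec hM, quadJ_lift3]
  have hq' : quadJ (lift3 (actM M z)) = nsq (actM M z) - 1 := quadJ_lift3 _
  rw [lift3_actM h2, quadJ_smul, hq, norm_inv, inv_pow] at hq'
  have hn : 0 < ‖(M *ᵥ lift3 z) 2‖ ^ 2 := by positivity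
  have key : nsq z - 1 = (nsq (actM M z) - 1) * ‖(M *ᵥ lift3 z) 2‖ ^ 2 := by
    rw [← hq', inv_mul_eq_div, div_mul_cancel₀ _ hn.ne']
  rw [eq_div_iff hn.ne']
  linear_combination key

/-- **THE INVARIANT DENSITY**: `normSq (jacDetMap (actM M) z) = ((1 − nsq (actM M z)) / (1 − nsq z)) ^ 3`. -/
theorem normSq_jacDetMap_actM (hM : Mᴴ * J * M = J) {z : Fin 2 → ℂ} (hz : z ∈ ball) :
    Complex.normSq (jacDetMap (actM M) z) = ((1 - nsq (actM M z)) / (1 - nsq z)) ^ 3 := by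
  have h2 := mulVec_lift3_two_ne_zero hM hz
  have hs : 0 < 1 - nsq z := sub_pos.mpr hz
  have hn : 0 < ‖(M *ᵥ lift3 z) 2‖ ^ 2 := by positivity
  rw [jacDetMap_actM M z h2, map_div₀, map_pow, normSq_det_of_unitaryJ hM, one_sub_nsq_actM hM hz,
    Complex.normSq_eq_norm_sq]
  field_simp

/-- **INVARIANCE** of `(1 − nsq)^{−3} dLeb` on the ball under `actM M`, `M ∈ U(2,1)`. -/
theorem integral_ball_actM_inv (hM : Mᴴ * J * M = J) (g : (Fin 2 → ℂ) → ℂ) :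
    ∫ w in ball, g w / ((1 - nsq w : ℝ) : ℂ) ^ 3 = ∫ z in ball, g (actM M z) / ((1 - nsq z : ℝ) : ℂ) ^ 3 := by
  rw [integral_ball_actM hM (fun w => g w / ((1 - nsq w : ℝ) : ℂ) ^ 3)]
  refine setIntegral_congr_fun isOpen_ball.measurableSet fun z hz => ?_
  rw [normSq_jacDetMap_actM hM hz]
  have hs : (1 - nsq z : ℝ) ≠ 0 := (sub_pos.mpr hz).ne'
  have hs' : (1 - nsq (actM M z) : ℝ) ≠ 0 := (sub_pos.mpr (actM_mem_ball hM hz)).ne'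
  have hsC : (1 : ℂ) - (nsq z : ℂ) ≠ 0 := by exact_mod_cast hs
  have hs'C : (1 : ℂ) - (nsq (actM M z) : ℂ) ≠ 0 := by exact_mod_cast hs'
  push_cast
  field_simp

end Invariant

end Summit.Ventures.HodgeRepro.Tier4.Line3

end
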